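/-
Copyright (c) 2026 the pub-hodgecm-mathlib formalisation cell (harness21).  Prover seat hodgecm-mathlib-K2Liu-p02 (g4), Track B «K2-LIT» ∕
hLiu418 #184♮, socket #42R `sig_K2LiuEisensteinResidueIsThetaIntegral`, DEFS leaf of organ (FI)+(R0) (LEAD F0P6-plan (g11) ruling «M-155e» (3)
«Ikeda DEFS», 2026-09-04).
-/
import Literature.NumberTheory.Automorphic.AdelicSchwartzBruhatDirectSum
import Summits.HodgeConjecture.HodgeConjecture.Theorems.K2LiuSchwartzBruhatFibreSlices

/-!
# Crux `HLiu418`, road `K2_Liu`, socket #42R — DEFS leaf: the FIBRE INTEGRAL and the RESTRICTION along a block of coordinates,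
# as linear maps `𝒮(𝔸_K^{ι₁ ⊕ ι₂}) →ₗ[ℂ] 𝒮(𝔸_K^{ι₁})`

Cell `hodgecm-mathlib`, crux item hLiu418 = `stmt-HodgeConjecture-24832`; squad K2 ∕ K2Liu, LEAD F0P6-plan (g11) «M-155e» (3) «Ikeda DEFS»,
prover K2Liu-p02 (g4), steward lineage of socket #42R.  DEFINITIONS WITH BODIES + `rfl` API (no instance ∕ notation ∕ named-fact hypothesis ∕
`sorry`, default heartbeats); lane `--supports stmt-HodgeConjecture-24832 --as helper` (count-neutral; definitions ⇒ review lane).  All the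
mathematics (memberships, integrability, linearity letters) is ★ `K2LiuSchwartzBruhatFibreSlices` + ★ `K2LiuSchwartzFibreIntegral`.

For a number field `K`, finite index types `ι₁ ι₂` and an additive Haar measure `ν` on `𝔸_K^{ι₂}`:

* **`restrictInl K ι₁ ι₂ : piSchwartzBruhat K (ι₁ ⊕ ι₂) →ₗ[ℂ] piSchwartzBruhat K ι₁`**, `(restrictInl Φ) x = Φ (Sum.elim x 0)` (`coe_restrictInl`,
  `restrictInl_apply`) — restriction to the block `𝔸^{ι₁} × {0}` [Weil1964, Chap. I n° 11; Chap. III n° 37] (the Rallis-tower ∕ «first occurrence»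
  restriction `S(V′^n) → S(V₀^n)` of theta correspondences is of this shape);
* **`fibreIntegral K ι₁ ι₂ ν : piSchwartzBruhat K (ι₁ ⊕ ι₂) →ₗ[ℂ] piSchwartzBruhat K ι₁`**, `(fibreIntegral ν Φ) x = ∫ Φ (Sum.elim x y) dν(y)`
  (`coe_fibreIntegral`, `fibreIntegral_apply`) — integration along the block `𝔸^{ι₂}` = the partial Fourier transform of [Weil1964, Chap. I
  n° 11 p. 159] at the origin of the dual block; the archimedean-place content of Ikeda's map `S(V′^n(𝔸)) → S(V₀^n(𝔸))` [KudlaRallis1994, §5],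
  which in the tree's «Re ∕ Im» Schrödinger models (★ `adelicGram`) realises — after a rational mover `ω(r_F(δ))` (★) and a reindexing
  (★ `piSBReindex`) — the section map of the first-term identity behind socket #42R ∕ #42F [Liu2021, App. B p. 104];
* on pure tensors (★ `tensorToSum` = `Φ₁ ⊠ Φ₂`): `restrictInl (Φ₁ ⊠ Φ₂) = Φ₂(0) • Φ₁` and `fibreIntegral ν (Φ₁ ⊠ Φ₂) = (∫ Φ₂ dν) • Φ₁`
  (`restrictInl_tensorToSum`, `fibreIntegral_tensorToSum`) — the separation-of-variables letters the undoubling organs (#44∕45R, #45D) use.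

NOT here: WHICH mover ∕ WHICH `8 + 4` coordinate split realises Ikeda's map for the isotropic 3-frame `V′₃ = X₁ ⊕ a′ ⊕ X₁*` of #42S∕#42F, and the
first-term constant (#42N ∕ #42F; next census).  HONEST LABEL.  Count-neutral DEFS leaf; it pays nothing by itself: `HC_CM` is proved only modulo
the 7 printed citations (2 remaining named inputs: hLiu418 = `stmt-HodgeConjecture-24832`, h413 = `stmt-HodgeConjecture-24833`) until rung 0 closes.
References: [Weil1964] Chap. I n° 11 p. 159, Chap. III n° 37–38; [KudlaRallis1994] §5; [Liu2021] App. B p. 104.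
-/

set_option autoImplicit false
-- the mandated namespace repeats the single-problem summit's segment (`HodgeConjecture.HodgeConjecture`)
set_option linter.dupNamespace false

noncomputable section

open MeasureTheory NumberField IsDedekindDomain
open scoped Classical
open Literature.NumberTheory.Automorphic
open Summit.HodgeConjecture.HodgeConjecture.Cruxes.HLiu418.K2LiuSchwartzBruhatFibreSlices

namespace Summit.HodgeConjecture.HodgeConjecture.Cruxes.HLiu418.K2LiuSchwartzBruhatFibreIntegralDefs

/-! ## §1 Restriction to the first block -/

section Restrict

variable (K : Type) [Field K] [NumberField K] (ι₁ ι₂ : Type) [Fintype ι₁] [Fintype ι₂]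

/-- **Restriction to the block `𝔸^{ι₁} × {0}`** as a linear map `𝒮(𝔸_K^{ι₁ ⊕ ι₂}) →ₗ[ℂ] 𝒮(𝔸_K^{ι₁})`, `Φ ↦ (x ↦ Φ (Sum.elim x 0))`
(membership ★ `restrict_mem_piSchwartzBruhat`). [cite: Weil1964, Chap. I n° 11] [cite: KudlaRallis1994, §5] -/
def restrictInl : piSchwartzBruhat K (ι₁ ⊕ ι₂) →ₗ[ℂ] piSchwartzBruhat K ι₁ where
  toFun Φ := ⟨fun x => (Φ : (ι₁ ⊕ ι₂ → AdeleRing (𝓞 K) K) → ℂ) (Sum.elim x 0), restrict_mem_piSchwartzBruhat Φ.2⟩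
  map_add' _ _ := rfl
  map_smul' _ _ := rfl

variable {K ι₁ ι₂}

/-- Values of `restrictInl` (as a function). [cite: Weil1964, Chap. I n° 11] -/
@[simp] theorem coe_restrictInl (Φ : piSchwartzBruhat K (ι₁ ⊕ ι₂)) :
    ((restrictInl K ι₁ ι₂ Φ : piSchwartzBruhat K ι₁) : (ι₁ → AdeleRing (𝓞 K) K) → ℂ) =
      fun x => (Φ : (ι₁ ⊕ ι₂ → AdeleRing (𝓞 K) K) → ℂ) (Sum.elim x 0) := rfl

/-- Values of `restrictInl` (pointwise). [cite: Weil1964, Chap. I n° 11] -/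
theorem restrictInl_apply (Φ : piSchwartzBruhat K (ι₁ ⊕ ι₂)) (x : ι₁ → AdeleRing (𝓞 K) K) :
    ((restrictInl K ι₁ ι₂ Φ : piSchwartzBruhat K ι₁) : (ι₁ → AdeleRing (𝓞 K) K) → ℂ) x =
      (Φ : (ι₁ ⊕ ι₂ → AdeleRing (𝓞 K) K) → ℂ) (Sum.elim x 0) := rfl

/-- **Restriction of a pure tensor**: `restrictInl (Φ₁ ⊠ Φ₂) = Φ₂(0) • Φ₁`. [cite: Weil1964, Chap. I n° 11] -/
theorem restrictInl_tensorToSum (Φ₁ : piSchwartzBruhat K ι₁) (Φ₂ : piSchwartzBruhat K ι₂) :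
    restrictInl K ι₁ ι₂ (tensorToSum K ι₁ ι₂ Φ₁ Φ₂) = (Φ₂ : (ι₂ → AdeleRing (𝓞 K) K) → ℂ) 0 • Φ₁ := by
  apply Subtype.ext
  funext x
  rw [coe_restrictInl, coe_tensorToSum, Submodule.coe_smul, Pi.smul_apply, smul_eq_mul]
  simp only [boxTensor_elim]
  rw [mul_comm]

end Restrict

/-! ## §2 The fibre integral along the second block -/

section Fibre

variable (K : Type) [Field K] [NumberField K] (ι₁ ι₂ : Type) [Fintype ι₁] [Fintype ι₂]
  [MeasurableSpace (AdeleRing (𝓞 K) K)] [BorelSpace (AdeleRing (𝓞 K) K)]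
  (ν : Measure (ι₂ → AdeleRing (𝓞 K) K)) [ν.IsAddHaarMeasure]

/-- **Integration along the block `𝔸^{ι₂}`** as a linear map `𝒮(𝔸_K^{ι₁ ⊕ ι₂}) →ₗ[ℂ] 𝒮(𝔸_K^{ι₁})`, `Φ ↦ (x ↦ ∫ Φ (Sum.elim x y) dν(y))` for an
additive Haar measure `ν` on `𝔸_K^{ι₂}` (membership ★ `fibreIntegral_mem_piSchwartzBruhat`; additivity uses the integrability of every fibre, ★
`fibreIntegral_add`).  The partial Fourier transform of [Weil1964] n° 11 at the origin; Ikeda's partial integration [KudlaRallis1994, §5].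
[cite: Weil1964, Chap. I n° 11 p. 159] [cite: KudlaRallis1994, §5] -/
def fibreIntegral : piSchwartzBruhat K (ι₁ ⊕ ι₂) →ₗ[ℂ] piSchwartzBruhat K ι₁ where
  toFun Φ := ⟨fun x => ∫ y, (Φ : (ι₁ ⊕ ι₂ → AdeleRing (𝓞 K) K) → ℂ) (Sum.elim x y) ∂ν, fibreIntegral_mem_piSchwartzBruhat ν Φ.2⟩
  map_add' Φ Ψ := Subtype.ext (fibreIntegral_add ν Φ.2 Ψ.2)
  map_smul' a Φ := Subtype.ext (fibreIntegral_smul ν a (Φ : (ι₁ ⊕ ι₂ → AdeleRing (𝓞 K) K) → ℂ))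

variable {K ι₁ ι₂}

/-- Values of `fibreIntegral` (as a function). [cite: Weil1964, Chap. I n° 11 p. 159] -/
@[simp] theorem coe_fibreIntegral (Φ : piSchwartzBruhat K (ι₁ ⊕ ι₂)) :
    ((fibreIntegral K ι₁ ι₂ ν Φ : piSchwartzBruhat K ι₁) : (ι₁ → AdeleRing (𝓞 K) K) → ℂ) =
      fun x => ∫ y, (Φ : (ι₁ ⊕ ι₂ → AdeleRing (𝓞 K) K) → ℂ) (Sum.elim x y) ∂ν := rfl

/-- Values of `fibreIntegral` (pointwise). [cite: Weil1964, Chap. I n° 11 p. 159] -/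
theorem fibreIntegral_apply (Φ : piSchwartzBruhat K (ι₁ ⊕ ι₂)) (x : ι₁ → AdeleRing (𝓞 K) K) :
    ((fibreIntegral K ι₁ ι₂ ν Φ : piSchwartzBruhat K ι₁) : (ι₁ → AdeleRing (𝓞 K) K) → ℂ) x =
      ∫ y, (Φ : (ι₁ ⊕ ι₂ → AdeleRing (𝓞 K) K) → ℂ) (Sum.elim x y) ∂ν := rfl

/-- Every fibre of `Φ ∈ 𝒮(𝔸_K^{ι₁ ⊕ ι₂})` is integrable (★ `integrable_fibre_of_mem`, restated on the bundled carrier for consumers).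
[cite: Weil1964, Chap. I n° 11 p. 159] -/
theorem integrable_fibre (Φ : piSchwartzBruhat K (ι₁ ⊕ ι₂)) (x : ι₁ → AdeleRing (𝓞 K) K) :
    Integrable (fun y => (Φ : (ι₁ ⊕ ι₂ → AdeleRing (𝓞 K) K) → ℂ) (Sum.elim x y)) ν :=
  integrable_fibre_of_mem ν Φ.2 x

/-- **Fibre integral of a pure tensor**: `fibreIntegral ν (Φ₁ ⊠ Φ₂) = (∫ Φ₂ dν) • Φ₁` (separation of variables).
[cite: Weil1964, Chap. I n° 11 p. 159] -/
theorem fibreIntegral_tensorToSum (Φ₁ : piSchwartzBruhat K ι₁) (Φ₂ : piSchwartzBruhat K ι₂) :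
    fibreIntegral K ι₁ ι₂ ν (tensorToSum K ι₁ ι₂ Φ₁ Φ₂) = (∫ y, (Φ₂ : (ι₂ → AdeleRing (𝓞 K) K) → ℂ) y ∂ν) • Φ₁ := by
  apply Subtype.ext
  funext x
  rw [coe_fibreIntegral, coe_tensorToSum, Submodule.coe_smul, Pi.smul_apply, smul_eq_mul]
  simp only [boxTensor_elim]
  rw [integral_const_mul, mul_comm]

end Fibre

end Summit.HodgeConjecture.HodgeConjecture.Cruxes.HLiu418.K2LiuSchwartzBruhatFibreIntegralDefs

end
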